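import Summits.AnomalousDissipation.AnomalousDissipation.Theorems.MarginalStabilityChainBurgersLayerKHStubStrainedE

/-!
# Line `Sketch`, stub `stub_strained` (lead) — part F

part F: `slow_stability` — the a-priori estimate `‖m - m'‖_w ≤ C_S ‖g - g'‖_∞` for two solutions of the slow
fixed-point equation at the same `(α, h, λ)`; it yields uniqueness, Lipschitz dependence on `λ` and `O(h)`-closeness.
-/

set_option linter.dupNamespace false

noncomputable section

open Complex MeasureTheory Filter Topology Set Metric intervalIntegral

namespace Summit.AnomalousDissipation.AnomalousDissipation.Theorems.BurgersLayerKH.Sheet.Strained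

/-! ## §H Stability of the slow fixed-point equation (uniqueness, Lipschitz dependence, closeness) -/

/-- **Stability at fixed `(α, h, λ)`.**  If `m = g - ∫_{t>y} k_α e^{αt} Ω` and `m' = g' - ∫_{t>y} k_α e^{αt} Ω'`
with `Ω, Ω'` Gaussian-class resolvent solutions for the sources `-iU''e^{-αt}m`, `-iU''e^{-αt}m'`, both `m, m'`
continuous of linear growth, and `‖g - g'‖ ≤ δ`, then `‖m(y) - m'(y)‖ ≤ C_S δ (1+|y|)` for `0 < h ≤ h₀`:
the difference solves the Volterra equation with source `g - g' - hJ(m - m')`, `‖hJ(d)‖ ≤ h C⋆|K|e⁹‖d‖_w/ℓ`.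
This yields uniqueness (`g = g'`), Lipschitz dependence on `λ` and `O(h)`-closeness to the `h = 0`
Jost solution. [folklore] -/
theorem slow_stability {α ℓ K : ℝ} (hα : 0 < α) (hα1 : α ≤ 1) (hℓ : 0 < ℓ) (hVolt : VolterraPackage 1 (1 / ℓ)) (hRes : ResolventBound K) (hUq : ∀ lam : ℂ, 0 < lam.re → ∀ h : ℝ, 0 < h → ResolventUniqueAt α h lam) : ∃ h₀ : ℝ, 0 < h₀ ∧ ∃ CS : ℝ, 0 ≤ CS ∧ ∀ h : ℝ, 0 < h → h ≤ h₀ → ∀ lam : ℂ, ℓ ≤ lam.re → ∀ (m m' Ω Ω' g g' : ℝ → ℂ) (B δ : ℝ), Continuous m → Continuous m' → (∀ y, ‖m y‖ ≤ B * (1 + |y|)) → (∀ y, ‖m' y‖ ≤ B * (1 + |y|)) → IsResolventSol α h lam (fun t => -(I * Upp t) * ((Real.exp (-(α * t)) : ℂ) * m t)) Ω → IsResolventSol α h lam (fun t => -(I * Upp t) * ((Real.exp (-(α * t)) : ℂ) * m' t)) Ω' → (∀ y, m y = g y - ∫ t in Ioi y, (volterraKernel α (t - y) : ℂ) * ((Real.exp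 (α * t) : ℂ) * Ω t)) → (∀ y, m' y = g' y - ∫ t in Ioi y, (volterraKernel α (t - y) : ℂ) * ((Real.exp (α * t) : ℂ) * Ω' t)) → (∀ y, ‖g y - g' y‖ ≤ δ) → ∀ y, ‖m y - m' y‖ ≤ CS * δ * (1 + |y|) := by
  obtain ⟨CV, hCV⟩ := hVolt
  obtain ⟨Cstar, hCstar0, hIBP⟩ := ibp_estimate hα hℓ
  set CV' : ℝ := max CV 1 with hCV'
  have hCV'1 : 1 ≤ CV' := le_max_right _ _
  have hCV'0 : 0 < CV' := lt_of_lt_of_le zero_lt_one hCV'1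
  set cJ : ℝ := Cstar * |K| * Real.exp 9 / ℓ with hcJ
  have hcJ0 : 0 ≤ cJ := by positivity
  set h₀ : ℝ := min ℓ (1 / (2 * CV' * cJ + 1)) with hh₀
  have hh₀pos : 0 < h₀ := lt_min hℓ (by positivity)
  refine ⟨h₀, hh₀pos, 2 * CV', by positivity, ?_⟩
  intro h hh hhle lam hlam m m' Ω Ω' g g' B δ hmc hm'c hmb hm'b hΩ hΩ' hmeq hm'eq hgg'
  have hlam0 : 0 < lam.re := hℓ.trans_le hlam
  have hhℓ : h ≤ lam.re := (hhle.trans (min_le_left _ _)).trans hlam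
  have hhsmall : 2 * CV' * cJ * h ≤ 1 := by
    have h1 : h ≤ 1 / (2 * CV' * cJ + 1) := hhle.trans (min_le_right _ _)
    rw [le_div_iff₀ (by positivity)] at h1
    nlinarith
  have hden : ∀ t, lam + I * (U t : ℂ) ≠ 0 := lam_add_ne_zero hlam0
  -- the Rayleigh potential
  obtain ⟨V, hV⟩ : ∃ V : ℝ → ℂ, V = fun t => I * (Upp t : ℂ) / (lam + I * (U t : ℂ)) := ⟨_, rfl⟩
  have hVc : Continuous V := by
    rw [hV]
    have hc1 := SheetLimit.continuous_Upp
    have hc2 := differentiable_U.continuous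
    refine Continuous.div (by fun_prop) (by fun_prop) hden
  have hVb : ∀ t, ‖V t‖ ≤ 1 / ℓ * Real.exp (-(t ^ 2) / 4) := by
    intro t
    rw [hV]; simp only
    rw [norm_div, norm_mul, Complex.norm_I, one_mul, Complex.norm_real, Real.norm_eq_abs]
    have hUpp : |Upp t| = |t| * Real.exp (-(t ^ 2) / 2) := by
      rw [Upp, abs_neg, abs_mul, abs_of_pos (Real.exp_pos _)]
    have hte : |t| * Real.exp (-(t ^ 2) / 2) ≤ Real.exp (-(t ^ 2) / 4) := by
      have h1 : |t| ≤ Real.exp (t ^ 2 / 4) := by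
        have := Real.add_one_le_exp (t ^ 2 / 4)
        nlinarith [sq_nonneg (|t| - 2), sq_abs t]
      calc |t| * Real.exp (-(t ^ 2) / 2) ≤ Real.exp (t ^ 2 / 4) * Real.exp (-(t ^ 2) / 2) :=
            mul_le_mul_of_nonneg_right h1 (Real.exp_pos _).le
        _ = Real.exp (-(t ^ 2) / 4) := by rw [← Real.exp_add]; congr 1; ring
    rw [hUpp, div_eq_mul_inv, mul_comm, one_div]
    exact mul_le_mul (inv_anti₀ hℓ (hlam.trans (re_le_norm_lam_add lam t))) hte (by positivity)
      (by positivity)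
  -- the difference `d`, its weight norm via a bounded continuous function
  have hw : ∀ y : ℝ, (0 : ℝ) < 1 + |y| := fun y => by positivity
  have hwc : Continuous (fun y : ℝ => (((1 + |y| : ℝ)) : ℂ)) := by fun_prop
  set d : ℝ → ℂ := fun y => m y - m' y with hd
  have hdc : Continuous d := hmc.sub hm'c
  have hB0 : 0 ≤ B := by
    have := (norm_nonneg _).trans (hmb 0); simpa using this
  have hdB : ∀ y, ‖d y‖ ≤ 2 * B * (1 + |y|) := by
    intro y
    calc ‖d y‖ ≤ ‖m y‖ + ‖m' y‖ := norm_sub_le _ _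
      _ ≤ B * (1 + |y|) + B * (1 + |y|) := add_le_add (hmb y) (hm'b y)
      _ = 2 * B * (1 + |y|) := by ring
  have hndb : ∀ y, ‖d y / ((1 + |y| : ℝ) : ℂ)‖ ≤ 2 * B := by
    intro y
    rw [norm_div, Complex.norm_real, Real.norm_of_nonneg (hw y).le, div_le_iff₀ (hw y)]
    exact hdB y
  set nd : BoundedContinuousFunction ℝ ℂ := BoundedContinuousFunction.ofNormedAddCommGroup
    (fun y => d y / ((1 + |y| : ℝ) : ℂ)) (hdc.div hwc fun y => by exact_mod_cast (hw y).ne') (2 * B) hndb with hnd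
  have hndapply : ∀ y, nd y = d y / ((1 + |y| : ℝ) : ℂ) := fun y => rfl
  have hdw : ∀ y, ‖d y‖ ≤ ‖nd‖ * (1 + |y|) := by
    intro y
    have h1 : ‖nd y‖ ≤ ‖nd‖ := nd.norm_coe_le_norm y
    rw [hndapply, norm_div, Complex.norm_real, Real.norm_of_nonneg (hw y).le, div_le_iff₀ (hw y)] at h1
    exact h1
  -- the resolvent solution attached to `d`
  set Fd : ℝ → ℂ := fun t => -(I * Upp t) * ((Real.exp (-(α * t)) : ℂ) * d t) with hFd
  have hFdc : Continuous Fd := by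
    have h1 := hdc; have h2 := SheetLimit.continuous_Upp; simp only [hFd]; fun_prop
  have hFdb : GaussBound Fd (Real.exp 9 * ‖nd‖) := gaussBound_source hα.le hα1 hdw
  set W : ℝ → ℂ := fun t => Ω t - Ω' t with hW
  have hWsol : IsResolventSol α h lam Fd W := by
    have h2 := resSol_add hΩ (resSol_smul hΩ' (-1))
    have hF : (fun y => -(I * ↑(Upp y)) * (↑(Real.exp (-(α * y))) * m y) +
        -1 * (-(I * ↑(Upp y)) * (↑(Real.exp (-(α * y))) * m' y))) = Fd := by
      funext t; simp only [hFd, hd]; ring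
    have hWf : (fun y => Ω y + -1 * Ω' y) = W := by funext t; simp only [hW]; ring
    rw [hF, hWf] at h2; exact h2
  obtain ⟨W', hW'sol, hW'b⟩ := hRes α hα hα1 lam hlam0 h hh hhℓ Fd hFdc _ hFdb
  have hWW' : W = W' := resSol_unique (hUq lam hlam0 h hh) hWsol hW'sol
  have hWb : GaussBound W (|K| * Real.exp 9 * ‖nd‖ / ℓ) := by
    rw [hWW']
    refine GaussBound.mono hW'b ?_
    have h1 : K * (Real.exp 9 * ‖nd‖) / lam.re ≤ |K| * (Real.exp 9 * ‖nd‖) / lam.re :=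
      div_le_div_of_nonneg_right (mul_le_mul_of_nonneg_right (le_abs_self K) (by positivity)) hlam0.le
    refine h1.trans ?_
    rw [mul_assoc |K|, ← mul_assoc]
    exact div_le_div_of_nonneg_left (by positivity) hℓ hlam
  -- the correction `J(d)` : bound, integrability, continuity
  obtain ⟨D', hD'⟩ := ou_bound_of_resSol hWsol hh hFdb hWb
  set q : ℝ → ℂ := fun t => ou α W t / (lam + I * U t) with hq
  have hqc : Continuous q := by
    simp only [hq]
    exact Continuous.div (continuous_ou hWsol.1) (by have := differentiable_U.continuous; fun_prop) hden
  have hqb : ∀ t, ‖q t‖ ≤ D' / ℓ * (1 + |t|) * Real.exp (-(t ^ 2) / 4) := by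
    intro t
    simp only [hq]; rw [norm_div]
    have hD'0 : 0 ≤ D' * (1 + |t|) * Real.exp (-(t ^ 2) / 4) := (norm_nonneg _).trans (hD' t)
    calc ‖ou α W t‖ / ‖lam + I * U t‖ ≤ (D' * (1 + |t|) * Real.exp (-(t ^ 2) / 4)) / ℓ :=
          div_le_div₀ hD'0 (hD' t) hℓ (hlam.trans (re_le_norm_lam_add lam t))
      _ = D' / ℓ * (1 + |t|) * Real.exp (-(t ^ 2) / 4) := by ring
  set Jd : ℝ → ℂ := fun y => ∫ t in Ioi y,
      (volterraKernel α (t - y) : ℂ) * (Real.exp (α * t) : ℂ) * (ou α W t / (lam + I * U t)) with hJd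
  have hJb : ∀ y, ‖Jd y‖ ≤ cJ * ‖nd‖ := by
    intro y
    obtain ⟨D, -, hD⟩ := resSol_deriv_decay hWsol hh.ne' hFdb
    have := hIBP lam hlam W hWsol.1 _ D D' hWb hD hD' y
    simp only [hJd]
    refine this.trans (le_of_eq ?_)
    rw [hcJ]; field_simp
  have hJint : ∀ y, IntegrableOn (fun t => (volterraKernel α (t - y) : ℂ) *
      (Real.exp (α * t) : ℂ) * (ou α W t / (lam + I * U t))) (Ioi y) := fun y => integrableOn_kernel_exp hα hqc hqb y
  have hJc : Continuous Jd := by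
    set f : ℝ → ℂ := fun t => (Real.exp (α * t) : ℂ) * q t with hf
    have hfc : Continuous f := by simp only [hf]; fun_prop
    have hM : 0 ≤ D' / ℓ := by
      have := (norm_nonneg _).trans (hqb 0); simpa using this
    have hfb : ∀ t, ‖f t‖ ≤ D' / ℓ * ((1 + |t|) ^ 1 * Real.exp (α * t) * Real.exp (-(t ^ 2) / 4)) := by
      intro t
      simp only [hf]; rw [norm_mul, Complex.norm_real, Real.norm_of_nonneg (Real.exp_pos _).le, pow_one]
      calc Real.exp (α * t) * ‖q t‖ ≤ Real.exp (α * t) * (D' / ℓ * (1 + |t|) * Real.exp (-(t ^ 2) / 4)) :=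
            mul_le_mul_of_nonneg_left (hqb t) (Real.exp_pos _).le
        _ = D' / ℓ * ((1 + |t|) * Real.exp (α * t) * Real.exp (-(t ^ 2) / 4)) := by ring
    obtain ⟨hfi, hgi⟩ := integrable_peg hfc hfb (-(2 * α))
    have hgi' : Integrable fun t => (Real.exp (-(2 * α * t)) : ℂ) * f t := by
      refine hgi.congr (Filter.Eventually.of_forall fun t => ?_); simp only; congr 2; ring
    have hm : ∀ y, Jd y = 0 + ∫ t in Ioi y, (volterraKernel α (t - y) : ℂ) * f t := by
      intro y; simp only [hJd, hf, hq, zero_add]; congr 1; funext t; ring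
    obtain ⟨DJ, hDJ, -, -, -⟩ := volterra_regularity hα hfc hfi hgi' 0 hm
    exact continuous_iff_continuousAt.2 fun y => (hDJ y).continuousAt
  -- integrability of the two representations
  have hΩint : ∀ (Ω₀ : ℝ → ℂ) (C₀ : ℝ), ContDiff ℝ 2 Ω₀ → GaussBound Ω₀ C₀ → ∀ y,
      IntegrableOn (fun t => (volterraKernel α (t - y) : ℂ) * ((Real.exp (α * t) : ℂ) * Ω₀ t)) (Ioi y) := by
    intro Ω₀ C₀ hc hb y
    have hC₀ : 0 ≤ C₀ := GaussBound.nonneg hb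
    have := integrableOn_kernel_exp hα (q := Ω₀) (M := C₀) hc.continuous (fun t => by
      calc ‖Ω₀ t‖ ≤ C₀ * Real.exp (-(t ^ 2) / 4) := hb t
        _ = C₀ * 1 * Real.exp (-(t ^ 2) / 4) := by ring
        _ ≤ C₀ * (1 + |t|) * Real.exp (-(t ^ 2) / 4) := by gcongr; linarith [abs_nonneg t]) y
    refine this.congr_fun (fun t _ => by ring) measurableSet_Ioi
  obtain ⟨CΩ, hCΩ⟩ := hΩ.2.1
  obtain ⟨CΩ', hCΩ'⟩ := hΩ'.2.1
  -- the Volterra equation of `d`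
  set src : ℝ → ℂ := fun y => (g y - g' y) - (h : ℂ) * Jd y with hsrc
  have hdeq : ∀ y, d y = src y + ∫ t in Ioi y, (volterraKernel α (t - y) : ℂ) * V t * d t := by
    intro y
    have hi1 := hΩint Ω CΩ hΩ.1 hCΩ y
    have hi2 := hΩint Ω' CΩ' hΩ'.1 hCΩ' y
    have hi3 := integrableOn_kernel hα hVc hVb hdc (hdw) y
    have hi4 := hJint y
    have hdec : ∀ t, (volterraKernel α (t - y) : ℂ) * ((Real.exp (α * t) : ℂ) * Ω t) -
        (volterraKernel α (t - y) : ℂ) * ((Real.exp (α * t) : ℂ) * Ω' t) =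
        -((volterraKernel α (t - y) : ℂ) * V t * d t) + (h : ℂ) *
          ((volterraKernel α (t - y) : ℂ) * (Real.exp (α * t) : ℂ) * (ou α W t / (lam + I * U t))) := by
      intro t
      have hdc' := resSol_decomp hWsol hlam0 t
      have hWt : W t = Fd t / (lam + I * U t) + (h : ℂ) * ou α W t / (lam + I * U t) := by
        linear_combination hdc'
      have hE : (Real.exp (α * t) : ℂ) * (Real.exp (-(α * t)) : ℂ) = 1 := by
        rw [← Complex.ofReal_mul, ← Real.exp_add, add_neg_cancel, Real.exp_zero, Complex.ofReal_one]
      have hsplit : (volterraKernel α (t - y) : ℂ) * ((Real.exp (α * t) : ℂ) * Ω t) -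
          (volterraKernel α (t - y) : ℂ) * ((Real.exp (α * t) : ℂ) * Ω' t) =
          (volterraKernel α (t - y) : ℂ) * ((Real.exp (α * t) : ℂ) * W t) := by simp only [hW]; ring
      rw [hsplit, hWt]
      simp only [hFd, hV, div_eq_mul_inv]
      linear_combination (-(I * (Upp t : ℂ) * d t * (volterraKernel α (t - y) : ℂ) *
        (lam + I * (U t : ℂ))⁻¹)) * hE
    have hgsub : g y - g' y = d y + ((∫ t in Ioi y, (volterraKernel α (t - y) : ℂ) * ((Real.exp (α * t) : ℂ) * Ω t)) -
        ∫ t in Ioi y, (volterraKernel α (t - y) : ℂ) * ((Real.exp (α * t) : ℂ) * Ω' t)) := by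
      simp only [hd]; rw [hmeq y, hm'eq y]; ring
    simp only [hsrc, hJd]
    rw [hgsub, ← integral_sub hi1 hi2, integral_congr_ae (ae_of_all _ hdec) |>.trans
      (integral_add hi3.neg (hi4.const_mul _)), MeasureTheory.integral_neg, MeasureTheory.integral_const_mul]
    ring
  -- size of the source
  have hδ0 : 0 ≤ δ := (norm_nonneg _).trans (hgg' 0)
  set Gs : ℝ := δ + h * cJ * ‖nd‖ with hGs
  have hGs0 : 0 ≤ Gs := by positivity
  have hsrcb : ∀ y, ‖src y‖ ≤ Gs := by
    intro y
    simp only [hsrc, hGs]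
    calc ‖g y - g' y - (h : ℂ) * Jd y‖ ≤ ‖g y - g' y‖ + ‖(h : ℂ) * Jd y‖ := norm_sub_le _ _
      _ ≤ δ + h * (cJ * ‖nd‖) := by
          refine add_le_add (hgg' y) ?_
          rw [norm_mul, Complex.norm_real, Real.norm_of_nonneg hh.le]
          exact mul_le_mul_of_nonneg_left (hJb y) hh.le
      _ = δ + h * cJ * ‖nd‖ := by ring
  have hsrcc : Continuous src := by
    have hgc : Continuous fun y => g y - g' y := by
      have : (fun y => g y - g' y) = fun y => d y + ((∫ t in Ioi y, (volterraKernel α (t - y) : ℂ) *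
          ((Real.exp (α * t) : ℂ) * Ω t)) - ∫ t in Ioi y, (volterraKernel α (t - y) : ℂ) * ((Real.exp (α * t) : ℂ) * Ω' t)) := by
        funext y; simp only [hd]; rw [hmeq y, hm'eq y]; ring
      rw [this]
      have hK : ∀ (Ω₀ : ℝ → ℂ) (C₀ : ℝ), ContDiff ℝ 2 Ω₀ → GaussBound Ω₀ C₀ →
          Continuous fun y => ∫ t in Ioi y, (volterraKernel α (t - y) : ℂ) * ((Real.exp (α * t) : ℂ) * Ω₀ t) := by
        intro Ω₀ C₀ hc hb
        set f : ℝ → ℂ := fun t => (Real.exp (α * t) : ℂ) * Ω₀ t with hf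
        have hfc : Continuous f := by have := hc.continuous; simp only [hf]; fun_prop
        have hfb : ∀ t, ‖f t‖ ≤ C₀ * ((1 + |t|) ^ 0 * Real.exp (α * t) * Real.exp (-(t ^ 2) / 4)) := by
          intro t; simp only [hf, pow_zero, one_mul]
          rw [norm_mul, Complex.norm_real, Real.norm_of_nonneg (Real.exp_pos _).le]
          calc Real.exp (α * t) * ‖Ω₀ t‖ ≤ Real.exp (α * t) * (C₀ * Real.exp (-(t ^ 2) / 4)) :=
                mul_le_mul_of_nonneg_left (hb t) (Real.exp_pos _).le
            _ = C₀ * (Real.exp (α * t) * Real.exp (-(t ^ 2) / 4)) := by ring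
        obtain ⟨hfi, hgi⟩ := integrable_peg hfc hfb (-(2 * α))
        have hgi' : Integrable fun t => (Real.exp (-(2 * α * t)) : ℂ) * f t := by
          refine hgi.congr (Filter.Eventually.of_forall fun t => ?_); simp only; congr 2; ring
        have hm : ∀ y, (fun y => ∫ t in Ioi y, (volterraKernel α (t - y) : ℂ) * ((Real.exp (α * t) : ℂ) * Ω₀ t)) y =
            0 + ∫ t in Ioi y, (volterraKernel α (t - y) : ℂ) * f t := by
          intro y; simp only [hf, zero_add]
        obtain ⟨DJ, hDJ, -, -, -⟩ := volterra_regularity hα hfc hfi hgi' 0 hm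
        exact continuous_iff_continuousAt.2 fun y => (hDJ y).continuousAt
      exact hdc.add ((hK Ω CΩ hΩ.1 hCΩ).sub (hK Ω' CΩ' hΩ'.1 hCΩ'))
    simp only [hsrc]
    have := hJc
    fun_prop
  -- comparison with the (scaled) package solution
  have hmain : ∀ y, ‖d y‖ ≤ CV' * Gs * (1 + |y|) := by
    intro y
    rcases hGs0.eq_or_lt with hG0' | hGpos
    · have hsrc0 : ∀ y, src y = 0 := fun y => norm_le_zero_iff.1 (by rw [hG0']; exact hsrcb y)
      have hpkg := (hCV α hα.le hα1 V hVc hVb (fun _ => (0 : ℂ)) continuous_const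
        (fun y => by rw [norm_zero]; positivity)).2
      have hzero : d = fun _ => 0 := hpkg d (fun _ => 0) hdc continuous_const ⟨2 * B, fun y => by rw [pow_one]; exact hdB y⟩
        ⟨0, fun y => by simp⟩ (fun y => by rw [hdeq y, hsrc0 y]) (fun y => by simp)
      have : d y = 0 := by rw [hzero]
      rw [this, norm_zero]; positivity
    · obtain ⟨⟨sol, hsc', hsb', hseq'⟩, huniq⟩ := hCV α hα.le hα1 V hVc hVb (fun y => src y / (Gs : ℂ))
        (hsrcc.div_const _) (fun y => by
          rw [norm_div, Complex.norm_real, Real.norm_of_nonneg hGpos.le, pow_one, div_le_iff₀ hGpos]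
          calc ‖src y‖ ≤ Gs := hsrcb y
            _ ≤ (1 + |y|) * Gs := le_mul_of_one_le_left hGpos.le (by linarith [abs_nonneg y]))
      have hne : (Gs : ℂ) ≠ 0 := by exact_mod_cast hGpos.ne'
      have hd' : ∀ y, (fun y => d y / (Gs : ℂ)) y = src y / (Gs : ℂ) +
          ∫ t in Ioi y, (volterraKernel α (t - y) : ℂ) * V t * (fun y => d y / (Gs : ℂ)) t := by
        intro y
        simp only
        rw [hdeq y, add_div]
        congr 1
        rw [div_eq_mul_inv, ← MeasureTheory.integral_mul_const]
        exact integral_congr_ae (Filter.Eventually.of_forall fun t => by simp only; ring)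
      have hdb' : ∃ B' : ℝ, ∀ y, ‖(fun y => d y / (Gs : ℂ)) y‖ ≤ B' * (1 + |y|) ^ 1 := by
        refine ⟨2 * B / Gs, fun y => ?_⟩
        simp only; rw [norm_div, Complex.norm_real, Real.norm_of_nonneg hGpos.le, div_mul_eq_mul_div, pow_one]
        exact div_le_div_of_nonneg_right (hdB y) hGpos.le
      have heq := huniq (fun y => d y / (Gs : ℂ)) sol ((hdc.div_const _)) hsc' hdb' ⟨CV, hsb'⟩ hd' hseq'
      have hdy : d y = (Gs : ℂ) * sol y := by
        have := congrFun heq y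
        beta_reduce at this
        rw [← this, mul_div_cancel₀ _ hne]
      have := hsb' y
      rw [pow_one] at this
      rw [hdy, norm_mul, Complex.norm_real, Real.norm_of_nonneg hGpos.le]
      calc Gs * ‖sol y‖ ≤ Gs * (CV * (1 + |y|)) := mul_le_mul_of_nonneg_left this hGpos.le
        _ ≤ Gs * (CV' * (1 + |y|)) := by gcongr; exact le_max_left _ _
        _ = CV' * Gs * (1 + |y|) := by ring
  -- the bound of the weight norm and the conclusion
  have hnorm : ‖nd‖ ≤ CV' * Gs :=
    (BoundedContinuousFunction.norm_le (by positivity)).2 fun y => by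
      rw [hndapply, norm_div, Complex.norm_real, Real.norm_of_nonneg (hw y).le, div_le_iff₀ (hw y)]
      exact hmain y
  have hnd2 : ‖nd‖ ≤ 2 * CV' * δ := by
    simp only [hGs] at hnorm
    nlinarith [hnorm, hhsmall, norm_nonneg nd, hCV'0.le, hδ0]
  intro y
  have := hdw y
  simp only [hd] at this
  calc ‖m y - m' y‖ ≤ ‖nd‖ * (1 + |y|) := this
    _ ≤ 2 * CV' * δ * (1 + |y|) := mul_le_mul_of_nonneg_right hnd2 (hw y).le

end Summit.AnomalousDissipation.AnomalousDissipation.Theorems.BurgersLayerKH.Sheet.Strained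

end
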